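import Literature.Topology.FourManifolds.FishtailTubeDZeroSouth
import HarnessLib

/-!
# The tube over the southern part of Gompf's disc, in latitude–angle form

Infrastructure for the explicit fishtail neighbourhood (R. Gompf, *More Cappell–Shaneson spheres
are standard*, Algebr. Geom. Topol. 10 (2010), proof of Thm 2.1 and Lemma 2.2; the named fact
`Literature.Topology.FourManifolds.gompf2010_framedTwist`). Between the south cap chart
(`FishtailTubeDZeroSouth.lean`) and the north cap chart (`FishtailTubeDZeroNorth.lean`) the part
`D⁰` of Gompf's disc is the flat annulus of the section sphere, parametrised by latitude `n` and
base angle `ϑ`. The tube over it, read in `X^σ`, is glued along `n` (`glue2`, `PiecewiseGlue.lean`):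

* `n < nA`: the rescaling `zoneS2` (scale `κ(n)` from the cone to the constant `λ`);
* `nA ≤ n < nB`: the frame switch `zoneS3` (sphere form → vertical tube);
* `nB ≤ n`: the flat-annulus zone `zoneM` (vertical tube, winding section further north),

`Literature.Topology.FourManifolds.tubeD0A`. Agreements on the slabs (`pieceA2_eq_pieceA3`,
`pieceA3_eq_pieceAM`), local diffeomorphism (`isLocalDiffeomorphAt_tubeD0A`). Everything is
proved; no named facts.

## References

* R. E. Gompf, *More Cappell–Shaneson spheres are standard*, Algebr. Geom. Topol. 10 (2010)
  1665–1681, proof of Thm 2.1 and Lemma 2.2. [GompfAGT2010]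
-/

noncomputable section

open scoped Real ContDiff Topology Manifold
open Set Function Filter Complex Metric

namespace Literature.Topology.FourManifolds

local notation "𝔼 " n:arg => EuclideanSpace ℝ (Fin n)

section Angular

variable {ε : ℝ} (hε : 0 < ε) (hε2 : ε ≤ 1 / 2) (δ lam c : ℝ) (kapS μS : ℝ → ℝ) (nA nB : ℝ)

/-- Piece A2: the south rescaling zone in `X^σ`. [folklore] -/
def pieceA2 (q : ℝ × ℝ × ℝ × ℝ) : (fishNu hε hε2).Surgered := toSurg (fishNu hε hε2) (zoneS2 kapS q)

/-- Piece A3: the south switch zone in `X^σ`. [folklore] -/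
def pieceA3 (q : ℝ × ℝ × ℝ × ℝ) : (fishNu hε hε2).Surgered := toSurg (fishNu hε hε2) (zoneS3 μS lam q)

/-- Piece AM: the flat-annulus zone in `X^σ`. [folklore] -/
def pieceAM (q : ℝ × ℝ × ℝ × ℝ) : (fishNu hε hε2).Surgered := toSurg (fishNu hε hε2) (zoneM δ lam c q)

/-- **The tube over the flat annulus of `D⁰`**, glued along the latitude at `nA`, `nB`. [folklore] -/
def tubeD0A : ℝ × ℝ × ℝ × ℝ → (fishNu hε hε2).Surgered :=
  glue2 nA (pieceA2 hε hε2 kapS) (glue2 nB (pieceA3 hε hε2 lam μS) (pieceAM hε hε2 δ lam c))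

variable {δ lam c kapS μS nA nB}

/-! #### Agreements -/

/-- **Pieces A2 and A3 agree** where `μ(n) = 0` and `κ(n) = λ`. [folklore] -/
theorem pieceA2_eq_pieceA3 {q : ℝ × ℝ × ℝ × ℝ} (hμ : μS q.1 = 0) (hk : kapS q.1 = lam) :
    pieceA2 hε hε2 kapS q = pieceA3 hε hε2 lam μS q := by
  simp only [pieceA2, pieceA3, zoneS2_apply, zoneS3_apply]
  rw [switchXReal_of_mu_zero (by exact hμ), scaleReal_congr (kap' := fun _ ↦ lam) (by exact hk)]

/-- **Pieces A3 and AM agree** where `μ(n) = 1` and the real far section vanishes at the latitude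
(`σ_far (e^{in}, s) = 0` for all `s`, i.e. `n` south of the winding annulus). [folklore] -/
theorem pieceA3_eq_pieceAM {q : ℝ × ℝ × ℝ × ℝ} (hμ : μS q.1 = 1) (hσ : ∀ s, sigmaFar c δ (Circle.exp q.1) s = 0) :
    pieceA3 hε hε2 lam μS q = pieceAM hε hε2 δ lam c q := by
  simp only [pieceA3, pieceAM, zoneS3_apply, zoneM_apply, mtCoord]
  rw [switchXReal_of_mu_one (by exact hμ)]
  have hℓ : midEll c δ lam q.1 (baseOf (exp (q.2.1 * I))) q.2.2.2 = -(lam * q.2.2.2) := by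
    rw [midEll, hσ, zero_sub]
  have hx : expT (WithLp.toLp 2 ![q.1 + lam * q.2.2.2, lam * q.2.2.1, -(lam * q.2.2.2)]) =
      midT3 c δ lam q.1 (baseOf (exp (q.2.1 * I))) q.2.2.1 q.2.2.2 := by
    simp only [midT3, hℓ, expT]
    refine Prod.ext ?_ (Prod.ext ?_ ?_)
    · show Circle.exp _ = Circle.exp q.1 * (Circle.exp (-(lam * q.2.2.2)))⁻¹
      rw [← Circle.exp_neg, ← Circle.exp_add]
      congr 1; simp
    · simp
    · simp
  simp only at hx ⊢
  rw [hx]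

/-! #### Local diffeomorphism of the pieces -/

/-- **Piece A2 is a local diffeomorphism** at `(n, ϑ, a, b)`, `0 < n < 1/2`, `κ` smooth, `κ(n) ≠ 0`,
strictly admissible offsets. [folklore] -/
theorem isLocalDiffeomorphAt_pieceA2 (hkap : ContDiff ℝ ∞ kapS) {q : ℝ × ℝ × ℝ × ℝ} (hn : 0 < q.1) (hn1 : q.1 < 1 / 2)
    (hk : kapS q.1 ≠ 0) (hadm : (kapS q.1 * q.2.2.1) ^ 2 + (kapS q.1 * q.2.2.2) ^ 2 < q.1 ^ 2) :
    IsLocalDiffeomorphAt 𝓘(ℝ, ℝ × ℝ × ℝ × ℝ) 𝓘(ℝ, 𝔼 4) ∞ (pieceA2 hε hε2 kapS) q := by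
  have hZ := isLocalDiffeomorphAt_zoneS2 hkap hn hn1 hk hadm
  have hmem : zoneS2 kapS q ∈ (fishNu hε hε2).complement := by
    rw [zoneS2_apply, mtCoord]
    refine mtPt_mem_complement hε hε2 (expT_ne_one_of_fst ?_ ?_) (baseOf_mem' _).1 (baseOf_mem' _).2
    · simp only [scaleReal, Matrix.cons_val_zero, sphX]
      exact (Real.sqrt_pos.2 (by nlinarith [hadm])).ne'
    · simp only [scaleReal, Matrix.cons_val_zero, sphX]
      rw [abs_of_nonneg (Real.sqrt_nonneg _)]
      have : Real.sqrt (q.1 ^ 2 - (kapS q.1 * q.2.2.1) ^ 2 - (kapS q.1 * q.2.2.2) ^ 2) ≤ q.1 := by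
        rw [Real.sqrt_le_left hn.le]; nlinarith
      linarith [Real.pi_gt_three]
  exact hZ.comp (K := 𝓘(ℝ, 𝔼 4)) (P := (fishNu hε hε2).Surgered) (isLocalDiffeomorphAt_toSurg (ν := fishNu hε hε2) hmem)

/-- **Piece A3 is a local diffeomorphism** at `(n, ϑ, a, b)` under the hypotheses of the south switch
zone, `|λ b| < n`. [folklore] -/
theorem isLocalDiffeomorphAt_pieceA3 (hμ : ContDiff ℝ ∞ μS) (hμ01 : ∀ n, 0 ≤ μS n ∧ μS n ≤ 1) (hlam : lam ≠ 0)
    {q : ℝ × ℝ × ℝ × ℝ} (hn : 0 < q.1) (hn1 : q.1 < 1 / 2)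
    (hadm : (lam * q.2.2.1) ^ 2 + (lam * q.2.2.2) ^ 2 < q.1 ^ 2) (hb4 : |lam * q.2.2.2| < 1 / 4) (hbn : |lam * q.2.2.2| < q.1)
    (hder : -deriv μS q.1 * sphX q.1 (lam * q.2.2.1) (lam * q.2.2.2) +
        (1 - μS q.1) * (q.1 / Real.sqrt (q.1 ^ 2 - (lam * q.2.2.1) ^ 2 - (lam * q.2.2.2) ^ 2)) +
        (deriv μS q.1 * (q.1 + lam * q.2.2.2) + μS q.1 * 1) ≠ 0) :
    IsLocalDiffeomorphAt 𝓘(ℝ, ℝ × ℝ × ℝ × ℝ) 𝓘(ℝ, 𝔼 4) ∞ (pieceA3 hε hε2 lam μS) q := by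
  have hZ := isLocalDiffeomorphAt_zoneS3 hμ hμ01 hlam hn hn1 hadm hb4 hder
  have hsw := switchX_pos (μ := μS) (kap := lam) (n₀ := q.1) (a := q.2.2.1) (b := q.2.2.2)
    (hμ01 _).1 (hμ01 _).2 hadm hbn
  have hmem : zoneS3 μS lam q ∈ (fishNu hε hε2).complement := by
    rw [zoneS3_apply, mtCoord]
    refine mtPt_mem_complement hε hε2 (expT_ne_one_of_fst ?_ ?_) (baseOf_mem' _).1 (baseOf_mem' _).2
    · simp only [switchXReal, Matrix.cons_val_zero]
      exact hsw.ne'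
    · simp only [switchXReal, Matrix.cons_val_zero]
      rw [abs_of_pos hsw, switchX]
      have hS : sphX q.1 (lam * q.2.2.1) (lam * q.2.2.2) ≤ q.1 := by
        rw [sphX, Real.sqrt_le_left hn.le]; nlinarith
      have hS0 : 0 ≤ sphX q.1 (lam * q.2.2.1) (lam * q.2.2.2) := Real.sqrt_nonneg _
      have h1 := (hμ01 q.1).1
      have h2 := (hμ01 q.1).2
      have hbb : lam * q.2.2.2 ≤ 1 / 4 := by have := le_abs_self (lam * q.2.2.2); linarith
      nlinarith [Real.pi_gt_three, mul_le_mul_of_nonneg_left hS (sub_nonneg.2 h2),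
        mul_le_mul_of_nonneg_left (show q.1 + lam * q.2.2.2 ≤ 3 / 4 by linarith) h1]
  exact hZ.comp (K := 𝓘(ℝ, 𝔼 4)) (P := (fishNu hε hε2).Surgered) (isLocalDiffeomorphAt_toSurg (ν := fishNu hε hε2) hmem)

/-- The flat-annulus `T³` point is not `1` for `0 < n < 2π`. [folklore] -/
theorem midT3_ne_one_of_mem {n : ℝ} (hn : 0 < n) (hn' : n < 2 * π) (s a b : ℝ) : midT3 c δ lam n s a b ≠ 1 := by
  intro h
  have h13 := midT3_fst_mul (δ := δ) (lam := lam) (c := c) n s a b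
  rw [h] at h13
  have h1 : Circle.exp n = 1 := by simpa using h13.symm
  rw [Circle.exp_eq_one] at h1
  obtain ⟨m, hm⟩ := h1
  have hπ := Real.pi_pos
  rcases lt_trichotomy m 0 with hneg | hzero | hpos
  · have : (m : ℝ) ≤ -1 := by exact_mod_cast Int.le_sub_one_iff.2 hneg
    nlinarith
  · rw [hzero] at hm; simp at hm; linarith
  · have : (1 : ℝ) ≤ m := by exact_mod_cast hpos
    nlinarith

/-- **Piece AM is a local diffeomorphism** at `(n, ϑ, a, b)`, `0 < n < 2π` off the cut `c`,
`-π < c < 1`, `0 < δ ≤ 1/4`, `λ ≠ 0`. [folklore] -/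
theorem isLocalDiffeomorphAt_pieceAM (hc1 : -π < c) (hc2 : c < 1) (hδ : 0 < δ) (hδ' : δ ≤ 1 / 4) (hlam : lam ≠ 0)
    {q : ℝ × ℝ × ℝ × ℝ} (hn : 0 < q.1) (hn' : q.1 < 2 * π)
    (hcut : ((Circle.exp q.1 : Circle) : ℂ) * exp (-((c + π : ℝ) : ℂ) * I) ∈ slitPlane) :
    IsLocalDiffeomorphAt 𝓘(ℝ, ℝ × ℝ × ℝ × ℝ) 𝓘(ℝ, 𝔼 4) ∞ (pieceAM hε hε2 δ lam c) q := by
  have hZ := isLocalDiffeomorphAt_zoneM hc1 hc2 hδ hδ' hlam (q := q) fun s ↦ eventually_contDiffAt_sigmaFar hcut s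
  have hmem : zoneM δ lam c q ∈ (fishNu hε hε2).complement := by
    rw [zoneM_apply]
    exact mtPt_mem_complement hε hε2 (midT3_ne_one_of_mem hn hn' _ _ _) (baseOf_mem' _).1 (baseOf_mem' _).2
  exact hZ.comp (K := 𝓘(ℝ, 𝔼 4)) (P := (fishNu hε hε2).Surgered) (isLocalDiffeomorphAt_toSurg (ν := fishNu hε hε2) hmem)

/-! #### The glued tube -/

/-- **Plateau hypotheses of the angular `D⁰` tube.** [folklore] -/
structure D0APlateau (δ lam c : ℝ) (kapS μS : ℝ → ℝ) (nA nB η : ℝ) : Prop where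
  hkap : ContDiff ℝ ∞ kapS
  hμ : ContDiff ℝ ∞ μS
  hμ01 : ∀ n, 0 ≤ μS n ∧ μS n ≤ 1
  hlam : lam ≠ 0
  hη : 0 < η
  hc1 : -π < c
  hc2 : c < 1
  hδ : 0 < δ
  hδ' : δ ≤ 1 / 4
  hA0 : η < nA
  hAB : nA + η ≤ nB - η
  hB : nB + η < 1 / 2
  klam : ∀ n, nA - η < n → kapS n = lam
  mu0 : ∀ n, n < nA + η → μS n = 0
  mu1 : ∀ n, nB - η < n → μS n = 1
  sig0 : ∀ n, |n - nB| < η → ∀ s, sigmaFar c δ (Circle.exp n) s = 0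

/-- **The angular `D⁰` tube is a local diffeomorphism** at `(n, ϑ, a, b)`, `0 < n < 2π`, under the
plateau hypotheses and the piecewise hypotheses at the point. [folklore] -/
theorem isLocalDiffeomorphAt_tubeD0A {η : ℝ} (H : D0APlateau δ lam c kapS μS nA nB η) {q : ℝ × ℝ × ℝ × ℝ}
    (hn : 0 < q.1) (hn' : q.1 < 2 * π)
    (h2 : q.1 < nA + η → q.1 < 1 / 2 ∧ kapS q.1 ≠ 0 ∧ (kapS q.1 * q.2.2.1) ^ 2 + (kapS q.1 * q.2.2.2) ^ 2 < q.1 ^ 2)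
    (h3 : nA - η < q.1 → q.1 < nB + η →
      (lam * q.2.2.1) ^ 2 + (lam * q.2.2.2) ^ 2 < q.1 ^ 2 ∧ |lam * q.2.2.2| < 1 / 4 ∧ |lam * q.2.2.2| < q.1 ∧
      -deriv μS q.1 * sphX q.1 (lam * q.2.2.1) (lam * q.2.2.2) +
        (1 - μS q.1) * (q.1 / Real.sqrt (q.1 ^ 2 - (lam * q.2.2.1) ^ 2 - (lam * q.2.2.2) ^ 2)) +
        (deriv μS q.1 * (q.1 + lam * q.2.2.2) + μS q.1 * 1) ≠ 0)
    (hM : nB - η < q.1 → ((Circle.exp q.1 : Circle) : ℂ) * exp (-((c + π : ℝ) : ℂ) * I) ∈ slitPlane) :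
    IsLocalDiffeomorphAt 𝓘(ℝ, ℝ × ℝ × ℝ × ℝ) 𝓘(ℝ, 𝔼 4) ∞ (tubeD0A hε hε2 δ lam c kapS μS nA nB) q := by
  have A23 : ∀ q' : ℝ × ℝ × ℝ × ℝ, |q'.1 - nA| < η → pieceA2 hε hε2 kapS q' = pieceA3 hε hε2 lam μS q' :=
    fun q' hq' ↦ by
      obtain ⟨hl, hr⟩ := abs_lt.1 hq'
      exact pieceA2_eq_pieceA3 hε hε2 (H.mu0 q'.1 (by linarith)) (H.klam q'.1 (by linarith))
  have A3M : ∀ q' : ℝ × ℝ × ℝ × ℝ, |q'.1 - nB| < η → pieceA3 hε hε2 lam μS q' = pieceAM hε hε2 δ lam c q' :=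
    fun q' hq' ↦ by
      obtain ⟨hl, hr⟩ := abs_lt.1 hq'
      exact pieceA3_eq_pieceAM hε hε2 (H.mu1 q'.1 (by linarith)) (H.sig0 q'.1 hq')
  unfold tubeD0A
  refine isLocalDiffeomorphAt_glue2 H.hη (fun q' hq' ↦ ?_) (fun hlt ↦ ?_) (fun hgt ↦ ?_)
  · rw [A23 q' hq', glue2_of_lt (show q'.1 < nB by have := (abs_lt.1 hq').2; linarith [H.hAB, H.hη])]
  · obtain ⟨hq1, hk, hadm⟩ := h2 (by linarith [H.hη])
    exact isLocalDiffeomorphAt_pieceA2 hε hε2 H.hkap hn hq1 hk hadm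
  · refine isLocalDiffeomorphAt_glue2 H.hη A3M (fun hlt' ↦ ?_) (fun hgt' ↦ ?_)
    · obtain ⟨hadm, hb4, hbn, hder⟩ := h3 hgt (by linarith [H.hη])
      exact isLocalDiffeomorphAt_pieceA3 hε hε2 H.hμ H.hμ01 H.hlam hn (by linarith [H.hB, H.hη]) hadm hb4 hbn hder
    · exact isLocalDiffeomorphAt_pieceAM hε hε2 H.hc1 H.hc2 H.hδ H.hδ' H.hlam hn hn' (hM hgt')

end Angular

end Literature.Topology.FourManifolds
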